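/-
Copyright (c) 2026 the pub-hodgecm-mathlib formalisation cell (harness21).  Prover seat hodgecm-mathlib-A-p12 (g29): ROAD «HC-D» (holder F0P2-p01 (g23)),
brick D5(iii) FILE D «SLODOWY SLICE — FINAL: the square-zero local theorem on `↥𝔲₀`», 2026-09-02.
-/
import Summits.HodgeConjecture.HodgeConjecture.Theorems.F0P3cStCharTSHCDSlodowySliceAssembly   -- ★ p852197 (this seat) FILE B §5: `exists_nhds_setLIntegral_etaInv_lt_top_of_slice_transfers`
import Summits.HodgeConjecture.HodgeConjecture.Theorems.F0P3cStCharTSHCDSlodowySliceChart      -- (this seat) FILE C: `exists_slice_transfers`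
import Summits.HodgeConjecture.HodgeConjecture.Theorems.F0P3cStCharTSHCDSlodowySliceK          -- ★ p852192 (iii-K) (LH10-p01): `exists_slodowyLinearEquivK`, `exists_newtonData_slodowyK`, carriers
import Summits.HodgeConjecture.HodgeConjecture.Theorems.F0P3cStCharTSHCDAdTransport             -- ★ p852181 (AD) (F0P2-p06): `exists_adEquiv_traceZero`, `exists_nhds_setLIntegral_etaIota_lt_top_iff_ad`
import Literature.LinearAlgebra.Matrix.UnitaryThreeSlodowySliceDescent                          -- ★ (F) (F0P3-p02): `exists_slice_addEquiv`
import Literature.LinearAlgebra.Matrix.UnitaryThreeMinimalNilpotentWitt                         -- ★ (E) (F0P3-p02): `exists_unitary_conj_single_zero_two`, `isUnit_det_of_unitary`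
import Literature.NumberTheory.GaloisRepresentations.LocalFieldFiniteExtension                  -- ★ R1 frame: `nontriviallyNormedField`, `completeSpace_∕isUltrametricDist_nontriviallyNormedField`
import HarnessLib

/-!
# F0 · P3c · line LH6 «StCharTS» — ROAD «HC-D» brick D5(iii), FILE D «SLODOWY SLICE — FINAL: `|η|^{−1∕2}` IS LOCALLY `∫⁻`-FINITE AT EVERY SQUARE-ZERO POINT»

Cell `pub/hodgecm-mathlib`, crux H413 = `stmt-HodgeConjecture-24833` (lane `--supports`, helper); seat A-p12 (g29); ROAD «HC-D» (holder F0P2-p01 (g23)).  THEOREMS ONLY;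
sorry-free; no definition ∕ instance ∕ notation ∕ named fact; axioms TRIO.

WHAT IT DOES (the (B3) head consumed by GLOBAL-FINAL ★ `…HCDLieGlobalFinal` as its letter `hsq` and by the (T1) certificate).  Frame R3: `K` a non-archimedean local
field, `σ` a continuous involution of `K` with fixed field the closed image of `ι : F' →+* K`, a skew unit `lam`, `2` invertible, `3 ≠ 0`, `J = J₃` (letter `hJ`),
`𝔲₀ = {X | ᵗ(σX)J + JX = 0, tr X = 0}` with ANY additive Haar measure `μ₀`.  HYPOTHESES in GLOBAL's letters: `hreg` (D5(i): `ηι` locally finite at regular points)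
and `hss` (D5(ii): at split semisimple non-scalar points).  CONCLUSION: `ηι X = (↑√√|discr χ_X|_K)⁻¹` has finite `μ₀`-integral near every `X₀ ≠ 0` with
`X₀² = 0`.

PROOF.  §1 at the model point `N = c·E₀₂` (`σ c = −c`, `c ≠ 0`): inside the proof the valuation norm of R1 is put on `K` (`letI`), the carriers
`Q = 𝔲₀ ∩ range (ad E₂₀)`, `C = 𝔲₀ ∩ 𝔷(E₂₀)` are built with their Borel structures and `Measure.addHaar`, the descended chart `e` is ★ (F), its `K`-linear form
`eK` and NEWTON DATA are ★ (iii-K) (K1)+(K3) (box `r = γ = 1∕2`), FILE C turns them into the two TRANSFERS (down on a ball `W ∋ 0` of `↥C`, up at `0`) for the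
class function `ηι` (★ GLOBAL `continuous_etaInv`), and ★ FILE B §5 assembles (vertex + classification + (i)(ii)).  §2 at a general square-zero `X₀ ≠ 0`: ★ (E) WITT
gives a unitary `g` and a skew `c ≠ 0` with `X₀ = g N_c g⁻¹`, ★ (AD) realises `Ad(g)` as `↥𝔲₀ ≃ₜ+ ↥𝔲₀` preserving `ηι` and local `∫⁻`-finiteness for ANY Haar `μ₀`.
HONEST LABEL: count-neutral; closes no organ.  HC_CM is proved only modulo the 7 printed citations (2 remaining: hLiu418 = `stmt-HodgeConjecture-24832`,
h413 = `stmt-HodgeConjecture-24833`) until rung 0 closes.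

## References
* [HarishChandra1970] Harish-Chandra (notes by G. van Dijk), *Harmonic analysis on reductive p-adic groups*, LNM 162 (1970), Part VII §1 Thm. 15; Part V §4 Lemma 22.
* [Slodowy1980] P. Slodowy, *Simple Singularities and Simple Algebraic Groups*, LNM 815 (1980), §7.4.
* [Rogawski1990] J. Rogawski, *Automorphic Representations of Unitary Groups in Three Variables* (1990), §1.9 p. 8; §4.9 p. 54.
-/

set_option autoImplicit false
-- the mandated namespace has the single-problem summit's repeated segment (`HodgeConjecture.HodgeConjecture`)
set_option linter.dupNamespace false

noncomputable section

open MeasureTheory Filter Set Topology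
open scoped Matrix Matrix.Norms.Elementwise ENNReal NNReal
open Literature.NumberTheory.GaloisRepresentations Literature.NumberTheory.GaloisRepresentations.IsNonarchimedeanLocalField
open Literature.LinearAlgebra.Matrix
open Summit.HodgeConjecture.HodgeConjecture.Cruxes.H413.F0P3cStCharTSHCDSlodowySliceAssembly
open Summit.HodgeConjecture.HodgeConjecture.Cruxes.H413.F0P3cStCharTSHCDSlodowySliceChart
open Summit.HodgeConjecture.HodgeConjecture.Cruxes.H413.F0P3cStCharTSHCDSlodowySliceK
open Summit.HodgeConjecture.HodgeConjecture.Cruxes.H413.F0P3cStCharTSHCDAdTransport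
open Summit.HodgeConjecture.HodgeConjecture.Cruxes.H413.F0P3cStCharTSHCDescentSemisimpleSliceK

namespace Summit.HodgeConjecture.HodgeConjecture.Cruxes.H413.F0P3cStCharTSHCDSlodowySliceFinal

variable {K : Type*} [Field K] [ValuativeRel K] [TopologicalSpace K] [IsNonarchimedeanLocalField K]
  (σ : K →+* K) (hσ : ∀ x, σ (σ x) = x) (hσc : Continuous σ) [Invertible (2 : K)] (h3 : (3 : K) ≠ 0)
  {F' : Type*} [Field F'] [ValuativeRel F'] [TopologicalSpace F'] [IsNonarchimedeanLocalField F']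
  (ι : F' →+* K) (hι : IsClosedEmbedding ι) (hιr : ∀ x, σ x = x ↔ x ∈ Set.range ι)
  (lam : Kˣ) (hlam : σ lam = -lam)

/-! ## §1 The model point `N = c·E₀₂` -/

set_option maxHeartbeats 1600000 in
-- long statements (three R2 integrands, the `K`-carriers of (iii-K)); elaboration of the subtype coercions dominates
include hσ hσc ι hι hιr lam hlam h3 in
/-- **D5(iii) AT THE MODEL POINT `N = c·E₀₂`** (`σ c = −c`, `c ≠ 0`; `J = J₃`; any additive Haar measure `μ₀` on `↥𝔲₀`): given the road's local theorems (i) `hreg`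
and (ii) `hss` on `↥𝔲₀` in GLOBAL's letters, `ηι` has finite `μ₀`-integral on a neighbourhood of every `X₀ : ↥𝔲₀` with `↑X₀ = N`.  (★ (F) chart, ★ (iii-K) Newton
data, FILE C transfers, ★ FILE B §5 assembly; the valuation norm, the carriers `Q`, `C` and their Haar measures live inside the proof.)
[cite: HarishChandra1970, Part VII §1 Thm. 15; Part V §4 Lemma 22] [cite: Slodowy1980, §7.4] -/
theorem exists_nhds_setLIntegral_etaInv_lt_top_of_eq_single
    {J : Matrix (Fin 3) (Fin 3) K} (hJ : J = !![0, 0, 1; 0, 1, 0; 1, 0, 0]) {c : K} (hc : σ c = -c) (hc0 : c ≠ 0)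
    (𝔲₀ : AddSubgroup (Matrix (Fin 3) (Fin 3) K)) (h𝔲₀ : ∀ X, X ∈ 𝔲₀ ↔ (X.map σ)ᵀ * J + J * X = 0 ∧ Matrix.trace X = 0)
    [MeasurableSpace ↥𝔲₀] [BorelSpace ↥𝔲₀] (μ₀ : Measure ↥𝔲₀) [μ₀.IsAddHaarMeasure]
    (hreg : ∀ X₀ : ↥𝔲₀, LinearIndependent K ![(1 : Matrix (Fin 3) (Fin 3) K), (X₀ : Matrix (Fin 3) (Fin 3) K), (X₀ : Matrix (Fin 3) (Fin 3) K) ^ 2] →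
      ∃ U ∈ 𝓝 X₀, ∫⁻ X in U, ((NNReal.sqrt (NNReal.sqrt (IsNonarchimedeanLocalField.normAbs K (Matrix.charpoly (X : Matrix (Fin 3) (Fin 3) K)).discr)) : ℝ≥0∞))⁻¹ ∂μ₀ < ∞)
    (hss : ∀ X₀ : ↥𝔲₀, (∃ a b : K, a ≠ b ∧ ((X₀ : Matrix (Fin 3) (Fin 3) K) - a • (1 : Matrix (Fin 3) (Fin 3) K)) * ((X₀ : Matrix (Fin 3) (Fin 3) K) - b • 1) = 0 ∧
        ∀ a' : K, (X₀ : Matrix (Fin 3) (Fin 3) K) ≠ a' • 1) →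
      ∃ U ∈ 𝓝 X₀, ∫⁻ X in U, ((NNReal.sqrt (NNReal.sqrt (IsNonarchimedeanLocalField.normAbs K (Matrix.charpoly (X : Matrix (Fin 3) (Fin 3) K)).discr)) : ℝ≥0∞))⁻¹ ∂μ₀ < ∞) :
    ∀ X₀ : ↥𝔲₀, (X₀ : Matrix (Fin 3) (Fin 3) K) = Matrix.single (0 : Fin 3) (2 : Fin 3) c →
      ∃ U ∈ 𝓝 X₀, ∫⁻ X in U, ((NNReal.sqrt (NNReal.sqrt (IsNonarchimedeanLocalField.normAbs K (Matrix.charpoly (X : Matrix (Fin 3) (Fin 3) K)).discr)) : ℝ≥0∞))⁻¹ ∂μ₀ < ∞ := by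
  classical
  subst hJ
  have h2 : (2 : K) ≠ 0 := Invertible.ne_zero 2
  -- ===== R1 frame, inside the proof only =====
  letI : NontriviallyNormedField K := IsNonarchimedeanLocalField.nontriviallyNormedField K
  haveI : CompleteSpace K := IsNonarchimedeanLocalField.completeSpace_nontriviallyNormedField K
  haveI : IsUltrametricDist K := IsNonarchimedeanLocalField.isUltrametricDist_nontriviallyNormedField K
  haveI : ProperSpace K := ProperSpace.of_nontriviallyNormedField_of_weaklyLocallyCompactSpace K
  haveI : SecondCountableTopology K := secondCountable_of_proper
  -- ===== the carriers `Q = 𝔲₀ ∩ range (ad E₂₀)`, `C = 𝔲₀ ∩ 𝔷(E₂₀)` (★ (iii-K) carriers) =====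
  obtain ⟨Q, hQ⟩ : ∃ Q : AddSubgroup (Matrix (Fin 3) (Fin 3) K), ∀ Y, Y ∈ Q ↔ Y ∈ 𝔲₀ ∧ (Y 0 1 = 0 ∧ Y 0 2 = 0 ∧ Y 1 1 = 0 ∧ Y 1 2 = 0 ∧ Y 0 0 + Y 2 2 = 0) :=
    ⟨𝔲₀ ⊓ (LinearMap.range (LinearMap.mulLeft K (Matrix.single (2 : Fin 3) (0 : Fin 3) (1 : K)) - LinearMap.mulRight K (Matrix.single (2 : Fin 3) (0 : Fin 3) (1 : K)) :
        Module.End K (Matrix (Fin 3) (Fin 3) K))).toAddSubgroup,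
      fun Y => by rw [AddSubgroup.mem_inf, Submodule.mem_toAddSubgroup, mem_range_ad_single_two_zero_iff]⟩
  obtain ⟨C, hC⟩ : ∃ C : AddSubgroup (Matrix (Fin 3) (Fin 3) K), ∀ Z, Z ∈ C ↔ Z ∈ 𝔲₀ ∧
      Z * Matrix.single (2 : Fin 3) (0 : Fin 3) (1 : K) = Matrix.single (2 : Fin 3) (0 : Fin 3) 1 * Z :=
    ⟨𝔲₀ ⊓ (LinearMap.ker (LinearMap.mulLeft K (Matrix.single (2 : Fin 3) (0 : Fin 3) (1 : K)) - LinearMap.mulRight K (Matrix.single (2 : Fin 3) (0 : Fin 3) (1 : K)) :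
        Module.End K (Matrix (Fin 3) (Fin 3) K))).toAddSubgroup,
      fun Z => by rw [AddSubgroup.mem_inf, Submodule.mem_toAddSubgroup, mem_ker_ad_single_two_zero_iff]⟩
  -- ===== closedness ⇒ local compactness; Borel structures and Haar measures on `↥Q`, `↥C` =====
  have h𝔲₀cl : IsClosed (𝔲₀ : Set (Matrix (Fin 3) (Fin 3) K)) := by
    have : (𝔲₀ : Set (Matrix (Fin 3) (Fin 3) K)) =
        {X : Matrix (Fin 3) (Fin 3) K | (X.map σ)ᵀ * !![(0 : K), 0, 1; 0, 1, 0; 1, 0, 0] + !![(0 : K), 0, 1; 0, 1, 0; 1, 0, 0] * X = 0} ∩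
          {X | Matrix.trace X = 0} := Set.ext fun X => by simpa using h𝔲₀ X
    rw [this]
    exact (isClosed_skew σ _ hσc).inter (isClosed_eq (continuous_id.matrix_trace) continuous_const)
  have hentry : ∀ i j : Fin 3, Continuous fun X : Matrix (Fin 3) (Fin 3) K => X i j := fun i j => continuous_id.matrix_elem i j
  have hQcl : IsClosed (Q : Set (Matrix (Fin 3) (Fin 3) K)) := by
    have : (Q : Set (Matrix (Fin 3) (Fin 3) K)) = (𝔲₀ : Set (Matrix (Fin 3) (Fin 3) K)) ∩
        ({Y | Y 0 1 = 0} ∩ {Y | Y 0 2 = 0} ∩ {Y | Y 1 1 = 0} ∩ {Y | Y 1 2 = 0} ∩ {Y : Matrix (Fin 3) (Fin 3) K | Y 0 0 + Y 2 2 = 0}) := by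
      ext Y; simp only [SetLike.mem_coe, hQ, Set.mem_inter_iff, Set.mem_setOf_eq]; tauto
    rw [this]
    exact h𝔲₀cl.inter (((((isClosed_eq (hentry 0 1) continuous_const).inter (isClosed_eq (hentry 0 2) continuous_const)).inter
      (isClosed_eq (hentry 1 1) continuous_const)).inter (isClosed_eq (hentry 1 2) continuous_const)).inter
      (isClosed_eq ((hentry 0 0).add (hentry 2 2)) continuous_const))
  have hCcl : IsClosed (C : Set (Matrix (Fin 3) (Fin 3) K)) := by
    have : (C : Set (Matrix (Fin 3) (Fin 3) K)) = (𝔲₀ : Set (Matrix (Fin 3) (Fin 3) K)) ∩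
        {Z : Matrix (Fin 3) (Fin 3) K | Z * Matrix.single (2 : Fin 3) (0 : Fin 3) (1 : K) = Matrix.single (2 : Fin 3) (0 : Fin 3) 1 * Z} := by
      ext Z; simp only [SetLike.mem_coe, hC, Set.mem_inter_iff, Set.mem_setOf_eq]
    rw [this]
    exact h𝔲₀cl.inter (isClosed_eq (continuous_id.matrix_mul continuous_const) (continuous_const.matrix_mul continuous_id))
  haveI : LocallyCompactSpace (Matrix (Fin 3) (Fin 3) K) := inferInstanceAs (LocallyCompactSpace (Fin 3 → Fin 3 → K))
  haveI : LocallyCompactSpace ↥Q := hQcl.isClosedEmbedding_subtypeVal.locallyCompactSpace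
  haveI : LocallyCompactSpace ↥C := hCcl.isClosedEmbedding_subtypeVal.locallyCompactSpace
  letI : MeasurableSpace ↥Q := borel _
  haveI : BorelSpace ↥Q := ⟨rfl⟩
  letI : MeasurableSpace ↥C := borel _
  haveI : BorelSpace ↥C := ⟨rfl⟩
  -- ===== the descended chart ★ (F), its `K`-linear form and Newton data ★ (iii-K) (K1)+(K3), box `r = γ = 1∕2` =====
  obtain ⟨e, he⟩ := UnitaryThreeSliceDescent.exists_slice_addEquiv σ h2 hc hc0 𝔲₀ Q C h𝔲₀ hQ hC
  obtain ⟨eK, heK⟩ := exists_slodowyLinearEquivK (K := K) hc0 h2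
  obtain ⟨k₀, hNK⟩ := exists_newtonData_slodowyK c eK heK (r := 1 / 2) (γ := 1 / 2) (by norm_num) (by norm_num) (by norm_num)
  -- ===== FILE C: the two transfers for the class function `ηι` =====
  obtain ⟨W, hW, hdown, hup⟩ := exists_slice_transfers σ hσc hc 𝔲₀ Q C h𝔲₀ hQ hC e he eK heK
    (r := 1 / 2) (γ := 1 / 2) (by norm_num) (by norm_num) (by norm_num) (by norm_num) hNK μ₀ (Measure.addHaar : Measure ↥Q) (Measure.addHaar : Measure ↥C)
    (fun X : Matrix (Fin 3) (Fin 3) K => ((NNReal.sqrt (NNReal.sqrt (IsNonarchimedeanLocalField.normAbs K (Matrix.charpoly X).discr)) : ℝ≥0∞))⁻¹)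
    F0P3cStCharTSHCDLieGlobal.continuous_etaInv (fun X X' h => by simp only [h])
  -- ===== ★ FILE B §5: vertex + classification + (i)(ii) =====
  have hC' : ∀ X, X ∈ C ↔ ((X.map σ)ᵀ * !![(0 : K), 0, 1; 0, 1, 0; 1, 0, 0] + !![(0 : K), 0, 1; 0, 1, 0; 1, 0, 0] * X = 0 ∧ Matrix.trace X = 0) ∧
      X * Matrix.single (2 : Fin 3) (0 : Fin 3) (1 : K) = Matrix.single (2 : Fin 3) (0 : Fin 3) 1 * X := fun X => by rw [hC, h𝔲₀]
  exact exists_nhds_setLIntegral_etaInv_lt_top_of_slice_transfers σ hσ h3 ι hι hιr lam hlam rfl hc hc0 𝔲₀ h𝔲₀ μ₀ C hC' (Measure.addHaar : Measure ↥C)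
    hreg hss hW (fun Z hZ _ => hdown Z hZ) hup

/-! ## §2 Every non-zero square-zero point (Witt + `Ad`) -/

set_option maxHeartbeats 800000 in
-- long statement (three R2 integrands)
include hσ hσc ι hι hιr lam hlam h3 in
/-- **D5(iii) «SQUARE-ZERO POINTS ON `↥𝔲₀`» — the (B3) head of ROAD «HC-D»** (GLOBAL-FINAL's letter `hsq`).  Frame R3 (module docstring), `J = J₃` (letter `hJ`), any
additive Haar measure `μ₀` on `↥𝔲₀`; HYPOTHESES (i) `hreg`, (ii) `hss` in GLOBAL's letters.  CONCLUSION: for every `X₀ : ↥𝔲₀` with `X₀ ≠ 0`, `X₀² = 0`, the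
integrand `ηι X = (↑√√|discr χ_X|_K)⁻¹` has finite `μ₀`-integral on a neighbourhood of `X₀`.  Proof: ★ (E) WITT `X₀ = g N_c g⁻¹` with `g` unitary, `σ c = −c`,
`c ≠ 0`; ★ (AD) `Ad(g) : ↥𝔲₀ ≃ₜ+ ↥𝔲₀` transports local finiteness of the `Ad`-invariant `ηι` from `N_c` (§1) to `X₀`.
[cite: HarishChandra1970, Part VII §1 Thm. 15] [cite: Rogawski1990, §1.9 p. 8; §4.9 p. 54] [cite: Slodowy1980, §7.4] -/
theorem exists_nhds_setLIntegral_etaInv_lt_top_of_sq_zero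
    {J : Matrix (Fin 3) (Fin 3) K} (hJ : J = !![0, 0, 1; 0, 1, 0; 1, 0, 0])
    (𝔲₀ : AddSubgroup (Matrix (Fin 3) (Fin 3) K)) (h𝔲₀ : ∀ X, X ∈ 𝔲₀ ↔ (X.map σ)ᵀ * J + J * X = 0 ∧ Matrix.trace X = 0)
    [MeasurableSpace ↥𝔲₀] [BorelSpace ↥𝔲₀] (μ₀ : Measure ↥𝔲₀) [μ₀.IsAddHaarMeasure]
    (hreg : ∀ X₀ : ↥𝔲₀, LinearIndependent K ![(1 : Matrix (Fin 3) (Fin 3) K), (X₀ : Matrix (Fin 3) (Fin 3) K), (X₀ : Matrix (Fin 3) (Fin 3) K) ^ 2] →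
      ∃ U ∈ 𝓝 X₀, ∫⁻ X in U, ((NNReal.sqrt (NNReal.sqrt (IsNonarchimedeanLocalField.normAbs K (Matrix.charpoly (X : Matrix (Fin 3) (Fin 3) K)).discr)) : ℝ≥0∞))⁻¹ ∂μ₀ < ∞)
    (hss : ∀ X₀ : ↥𝔲₀, (∃ a b : K, a ≠ b ∧ ((X₀ : Matrix (Fin 3) (Fin 3) K) - a • (1 : Matrix (Fin 3) (Fin 3) K)) * ((X₀ : Matrix (Fin 3) (Fin 3) K) - b • 1) = 0 ∧
        ∀ a' : K, (X₀ : Matrix (Fin 3) (Fin 3) K) ≠ a' • 1) →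
      ∃ U ∈ 𝓝 X₀, ∫⁻ X in U, ((NNReal.sqrt (NNReal.sqrt (IsNonarchimedeanLocalField.normAbs K (Matrix.charpoly (X : Matrix (Fin 3) (Fin 3) K)).discr)) : ℝ≥0∞))⁻¹ ∂μ₀ < ∞) :
    ∀ X₀ : ↥𝔲₀, X₀ ≠ 0 → (X₀ : Matrix (Fin 3) (Fin 3) K) * (X₀ : Matrix (Fin 3) (Fin 3) K) = 0 →
      ∃ U ∈ 𝓝 X₀, ∫⁻ X in U, ((NNReal.sqrt (NNReal.sqrt (IsNonarchimedeanLocalField.normAbs K (Matrix.charpoly (X : Matrix (Fin 3) (Fin 3) K)).discr)) : ℝ≥0∞))⁻¹ ∂μ₀ < ∞ := by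
  classical
  subst hJ
  intro X₀ hX₀ hsq
  obtain ⟨hX₀skew, -⟩ := (h𝔲₀ _).1 X₀.2
  have hX₀0 : (X₀ : Matrix (Fin 3) (Fin 3) K) ≠ 0 := fun h => hX₀ (Subtype.ext h)
  -- ★ (E) Witt: `X₀ = g N_c g⁻¹`
  obtain ⟨g, c, hg, hc, hc0, hXg⟩ := UnitaryThreeWitt.exists_unitary_conj_single_zero_two σ hσ hX₀skew hX₀0 hsq
  have hdet : IsUnit g.det := UnitaryThreeWitt.isUnit_det_of_unitary σ hg
  -- ★ (AD): `Ad(g)` on `↥𝔲₀`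
  obtain ⟨Adg, hAdg, hAdgsymm⟩ := exists_adEquiv_traceZero σ hσ rfl 𝔲₀ h𝔲₀ hg
  have hN : ((Adg.symm X₀ : ↥𝔲₀) : Matrix (Fin 3) (Fin 3) K) = Matrix.single (0 : Fin 3) (2 : Fin 3) c := by
    rw [hAdgsymm, hXg]
    simp only [← Matrix.mul_assoc]
    rw [Matrix.nonsing_inv_mul _ hdet, Matrix.one_mul, Matrix.mul_assoc, Matrix.nonsing_inv_mul _ hdet, Matrix.mul_one]
  -- instances for the transport lemma
  have h𝔲₀cl : IsClosed (𝔲₀ : Set (Matrix (Fin 3) (Fin 3) K)) := by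
    haveI : T2Space K := (IsNonarchimedeanLocalField.isLocalField K).toT2Space
    have hlin : Continuous fun X : Matrix (Fin 3) (Fin 3) K => (X.map σ)ᵀ * !![(0 : K), 0, 1; 0, 1, 0; 1, 0, 0] + !![(0 : K), 0, 1; 0, 1, 0; 1, 0, 0] * X :=
      (((continuous_id.matrix_map hσc).matrix_transpose.matrix_mul continuous_const).add (continuous_const.matrix_mul continuous_id))
    have : (𝔲₀ : Set (Matrix (Fin 3) (Fin 3) K)) =
        {X : Matrix (Fin 3) (Fin 3) K | (X.map σ)ᵀ * !![(0 : K), 0, 1; 0, 1, 0; 1, 0, 0] + !![(0 : K), 0, 1; 0, 1, 0; 1, 0, 0] * X = 0} ∩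
          {X | Matrix.trace X = 0} := Set.ext fun X => by simpa using h𝔲₀ X
    rw [this]
    exact (isClosed_eq hlin continuous_const).inter (isClosed_eq (continuous_id.matrix_trace) continuous_const)
  haveI : SecondCountableTopology K := Literature.NumberTheory.Automorphic.secondCountableTopology_localField K
  haveI : SecondCountableTopology (Matrix (Fin 3) (Fin 3) K) := inferInstanceAs (SecondCountableTopology (Fin 3 → Fin 3 → K))
  haveI : SecondCountableTopology ↥𝔲₀ := TopologicalSpace.Subtype.secondCountableTopology _
  haveI : LocallyCompactSpace (Matrix (Fin 3) (Fin 3) K) := inferInstanceAs (LocallyCompactSpace (Fin 3 → Fin 3 → K))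
  haveI : LocallyCompactSpace ↥𝔲₀ := h𝔲₀cl.isClosedEmbedding_subtypeVal.locallyCompactSpace
  -- §1 at `N_c = Adg.symm X₀`, transported along `Ad(g)`
  have key := exists_nhds_setLIntegral_etaInv_lt_top_of_eq_single σ hσ hσc h3 ι hι hιr lam hlam rfl hc hc0 𝔲₀ h𝔲₀ μ₀ hreg hss (Adg.symm X₀) hN
  have h := (exists_nhds_setLIntegral_etaIota_lt_top_iff_ad 𝔲₀ μ₀ hdet Adg hAdg (Adg.symm X₀)).1 key
  rwa [ContinuousAddEquiv.apply_symm_apply] at h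

end Summit.HodgeConjecture.HodgeConjecture.Cruxes.H413.F0P3cStCharTSHCDSlodowySliceFinal

end
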